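import Summits.MatrixMultiplication.MatrixMultiplication.Theorems.LieRankDesigns.Negative.Basics
import Literature.Barriers.MatrixMultiplication.QuasirandomBarrier

/-!
# Negative lemmas for the crux `LieRankDesigns` (stmt-MatrixMultiplication-7614), part D: TPP and the abelian slice

Refuter-side (cdisprove) support; no theorem asserts a Theses statement positively.

* `tpp_of_rankSep`: `F_k`-separation ⇒ the tree's `TripleProductProperty`, so the quasirandom caps
  apply to every witness (`volume_le_of_cor35`, modulo the named fact `BCGPU2023_cor35`);
* `glOne_comm`, `sum_psi_matOne`, `levelSet_matOne_eq_univ` (Fourier inversion on `GL_1(𝔽_p)`),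
  `budget_matOne` (`= |GL_1(𝔽_p)|`), `not_design_matOne`, `not_lieRankDesigns_matOne`: the abelian
  slice `m = 1` of the crux is FALSE (already for `ε = 1`); every witness has `m ≥ 2`, `k ≥ 1`.
-/

noncomputable section

open scoped BigOperators
open Literature.RepresentationTheory.FiniteGroups

namespace Summit.MatrixMultiplication.MatrixMultiplication.Theorems.LieRankDesigns.Negative

open Summit.MatrixMultiplication.MatrixMultiplication.Theses.LevelGradedCohnUmans

variable {p m : ℕ}

/-! ## Separation implies the triple product property (so every catalogued TPP cap applies) -/

section TPP

variable [Fact p.Prime] {k : ℕ} {X Y Z : Finset (GLm p m)}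

/-- **`F_k`-separation ⇒ TPP** (the tree's `TripleProductProperty`, Cohn–Umans Def. 2.1): from
`s s'⁻¹ · t t'⁻¹ · u u'⁻¹ = 1` one gets `s'⁻¹ t t'⁻¹ u = s⁻¹ t t⁻¹ u'`, and the separating function of
the target `(s, u')` takes the value `1` there, forcing `s' = s`, `t = t'`, `u = u'`. Hence
`BCGPU2023_thm32` / `cor35` (QuasirandomBarrier) bound the volume of every witness of the crux. -/
theorem tpp_of_rankSep (hsep : RankSep k X Y Z) :
    Literature.Combinatorics.Additive.TripleProductProperty X Y Z := by
  intro s hs s' hs' t ht t' ht' u hu u' hu' h1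
  obtain ⟨c, -, hsepc⟩ := hsep s hs u' hu'
  have htarget := hsepc s hs t ht t ht u' hu'
  rw [if_pos ⟨rfl, rfl, rfl⟩] at htarget
  have hother := hsepc s' hs' t ht t' ht' u hu
  have heq : s'⁻¹ * t * t'⁻¹ * u = s⁻¹ * t * t⁻¹ * u' := by
    have h2 : s'⁻¹ * t * t'⁻¹ * u = s⁻¹ * (s * s'⁻¹ * (t * t'⁻¹) * (u * u'⁻¹)) * u' := by group
    rw [h1] at h2
    rw [h2]; group
  rw [heq, htarget] at hother
  by_cases hc : s' = s ∧ t = t' ∧ u = u'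
  · exact ⟨hc.1.symm, hc.2.1, hc.2.2⟩
  · rw [if_neg hc] at hother
    exact absurd hother one_ne_zero

/-- Consequence: the Cohn–Umans / BCGPU packing cap `|X||Y||Z| ≤ |G|^{3/2}/√2 + |G|` (the tree's
`BCGPU2023_cor35`, proved in `QuasirandomBarrierProofs`) applies to every `F_k`-separated triple —
stated here modulo the named fact to keep this file's imports light. -/
theorem volume_le_of_cor35 (h35 : Literature.Barriers.MatrixMultiplication.BCGPU2023_cor35)
    (hsep : RankSep k X Y Z) :
    volume X Y Z ≤ (Fintype.card (GLm p m) : ℝ) ^ (3 / 2 : ℝ) / Real.sqrt 2 + Fintype.card (GLm p m) :=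
  h35 (GLm p m) X Y Z (tpp_of_rankSep hsep)

end TPP

/-! ## The abelian slice `m = 1` is dead for `ε ≤ 1` -/

section Abelian

/-- `GL_1(𝔽_p)` is commutative. [folklore] -/
theorem glOne_comm (a b : GLm p 1) : a * b = b * a := by
  apply Units.ext
  ext i j
  fin_cases i; fin_cases j
  simp [Matrix.mul_apply, mul_comm]

variable [Fact p.Prime]

/-- Orthogonality of additive characters on `1 × 1` matrices:
`Σ_{M ∈ M_1(𝔽_p)} ψ(tr(M D)) = p·[D = 0]`. [folklore] -/
theorem sum_psi_matOne (D : Mat p 1) :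
    ∑ M : Mat p 1, ZMod.stdAddChar (Matrix.trace (M * D)) = if D = 0 then (p : ℂ) else 0 := by
  classical
  have h := AddChar.sum_mulShift (R := ZMod p) (D 0 0) (ZMod.isPrimitive_stdAddChar p)
  -- `M_1(𝔽_p) ≃ 𝔽_p` by the unique entry
  let e : ZMod p ≃ Mat p 1 :=
    { toFun := fun a => Matrix.of fun _ _ => a
      invFun := fun M => M 0 0
      left_inv := fun a => rfl
      right_inv := fun M => by ext i j; fin_cases i; fin_cases j; rfl }
  rw [← Equiv.sum_comp e]
  have hterm : ∀ a : ZMod p, ZMod.stdAddChar (Matrix.trace (e a * D)) =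
      ZMod.stdAddChar (a * D 0 0) := by
    intro a
    congr 1
    rw [Matrix.trace_fin_one, Matrix.mul_apply]
    simp [e]
  simp_rw [hterm]
  rw [h]
  have hD : D 0 0 = 0 ↔ D = 0 := by
    constructor
    · intro h0; ext i j; fin_cases i; fin_cases j; exact h0
    · intro h0; rw [h0]; rfl
  by_cases hD0 : D = 0
  · rw [if_pos (hD.mpr hD0), if_pos hD0, ZMod.card]
  · rw [if_neg (fun h0 => hD0 (hD.mp h0)), if_neg hD0, Nat.cast_zero]

/-- **Fourier inversion on `GL_1(𝔽_p)`**: for `k ≥ 1` every function is of level `k`, i.e.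
`levelSet p 1 k = univ` (so the graded budget at `m = 1` is the FULL budget). [folklore] -/
theorem levelSet_matOne_eq_univ {k : ℕ} (hk : 1 ≤ k) : levelSet p 1 k = Set.univ := by
  classical
  refine Set.eq_univ_of_forall fun f => ?_
  have hp0 : (p : ℂ) ≠ 0 := Nat.cast_ne_zero.mpr (NeZero.ne p)
  refine ⟨fun M => (p : ℂ)⁻¹ * ∑ h : GLm p 1, f h * ZMod.stdAddChar (Matrix.trace (M * (-(h : Mat p 1)))),
    ?_, fun g => ?_⟩
  · intro M hM
    exfalso
    have := Matrix.rank_le_width M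
    omega
  · unfold fourierFn
    -- expand and swap the sums
    have hexp : ∀ M : Mat p 1,
        ((p : ℂ)⁻¹ * ∑ h : GLm p 1, f h * ZMod.stdAddChar (Matrix.trace (M * (-(h : Mat p 1))))) *
          ZMod.stdAddChar (Matrix.trace (M * (g : Mat p 1))) =
        (p : ℂ)⁻¹ * ∑ h : GLm p 1, f h * ZMod.stdAddChar (Matrix.trace (M * ((g : Mat p 1) - (h : Mat p 1)))) := by
      intro M
      rw [mul_assoc, Finset.sum_mul]
      congr 1
      refine Finset.sum_congr rfl fun h _ => ?_
      rw [mul_assoc, ← AddChar.map_add_eq_mul, ← Matrix.trace_add, ← Matrix.mul_add,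
        neg_add_eq_sub]
    simp_rw [hexp]
    rw [← Finset.mul_sum, Finset.sum_comm]
    simp_rw [← Finset.mul_sum, sum_psi_matOne, sub_eq_zero]
    have hval : ∀ h : GLm p 1, f h * (if ((g : Mat p 1) = (h : Mat p 1)) then (p : ℂ) else 0) =
        if g = h then f g * p else 0 := by
      intro h
      by_cases hgh : g = h
      · subst hgh; simp
      · rw [if_neg (fun e => hgh (Units.ext e)), if_neg hgh, mul_zero]
    simp_rw [hval]
    rw [Finset.sum_ite_eq, if_pos (Finset.mem_univ _), ← mul_assoc, mul_comm ((p : ℂ)⁻¹),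
      mul_assoc, inv_mul_cancel₀ hp0, mul_one]

/-- For a commutative group all irreducible characters have `χ(1) = 1`, so the FULL budget equals
`|G|` for every exponent: here `budget p 1 k s = |GL_1(𝔽_p)| = p − 1` for `k ≥ 1`. [folklore] -/
theorem budget_matOne {k : ℕ} (hk : 1 ≤ k) (s : ℝ) :
    budget p 1 k s = Fintype.card (GLm p 1) := by
  classical
  haveI : IsMulCommutative (GLm p 1) := ⟨⟨glOne_comm⟩⟩
  have hone : ∀ χ ∈ irrChars (GLm p 1), χ 1 = 1 := by
    rintro χ ⟨V, _, _, _, ρ, hρ, rfl⟩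
    haveI := hρ
    rw [Representation.char_one, Representation.IsIrreducible.finrank_eq_one_of_isMulCommutative ρ,
      Nat.cast_one]
  have hfin : (irrChars (GLm p 1)).Finite := irrChars_finite_holds _
  -- number of irreducible characters = |G| via `∑ χ(1)² = |G|`
  have hcount : (hfin.toFinset.card : ℂ) = Fintype.card (GLm p 1) := by
    have h := sum_sq_charDegrees_holds (GLm p 1)
    rw [finsum_mem_eq_finite_toFinset_sum _ hfin, Nat.card_eq_fintype_card] at h
    rw [← h, Finset.sum_congr rfl fun χ hχ => by rw [hone χ (hfin.mem_toFinset.mp hχ), one_pow],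
      Finset.sum_const, nsmul_eq_mul, mul_one]
  have hcount' : hfin.toFinset.card = Fintype.card (GLm p 1) := by exact_mod_cast hcount
  unfold budget
  rw [levelSet_matOne_eq_univ hk, Set.inter_univ, finsum_mem_eq_finite_toFinset_sum _ hfin,
    Finset.sum_congr rfl fun χ hχ => by rw [hone χ (hfin.mem_toFinset.mp hχ), Complex.one_re,
      Real.one_rpow], Finset.sum_const, nsmul_eq_mul, mul_one, hcount']

variable {k : ℕ} {X Y Z : Finset (GLm p 1)}

/-- No design in `GL_1(𝔽_p)` beats an exponent `2 + ε` with `0 < ε ≤ 1`: for `k = 0` by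
`not_design_levelZero`; for `k ≥ 1` the budget is `|G| ≥ |X||Y||Z| ≥ V^{(2+ε)/3}` (abelian TPP bound). -/
theorem not_design_matOne {ε : ℝ} (hε : 0 < ε) (hε1 : ε ≤ 1) (hsep : RankSep k X Y Z) :
    ¬ budget p 1 k (2 + ε) < volume X Y Z ^ ((2 + ε) / 3) := by
  intro hlt
  rcases Nat.eq_zero_or_pos k with rfl | hk
  · exact not_design_levelZero hε hsep hlt
  · have hV2 := two_le_volume hε hlt
    have hTPP := tpp_of_rankSep hsep
    have hVG : X.card * Y.card * Z.card ≤ Fintype.card (GLm p 1) :=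
      Literature.Barriers.MatrixMultiplication.tripleProductProperty_card_le_of_comm glOne_comm hTPP
    rw [budget_matOne hk] at hlt
    have hV1 : (1 : ℝ) ≤ volume X Y Z := by
      unfold volume; exact_mod_cast (by omega : 1 ≤ X.card * Y.card * Z.card)
    have hpow : volume X Y Z ^ ((2 + ε) / 3) ≤ volume X Y Z := by
      conv_rhs => rw [← Real.rpow_one (volume X Y Z)]
      exact Real.rpow_le_rpow_of_exponent_le hV1 (by linarith)
    have hVG' : volume X Y Z ≤ Fintype.card (GLm p 1) := by unfold volume; exact_mod_cast hVG
    linarith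

end Abelian

/-- **STRENGTHENING REFUTED (`m = 1`).**  The abelian slice `m = 1` of `LieRankDesigns` is false
(already for `ε = 1`): `GL_1(𝔽_p) = 𝔽_p^×` cannot host a graded design. Any witness has `m ≥ 2`. -/
theorem not_lieRankDesigns_matOne :
    ¬ (∀ ε : ℝ, 0 < ε → ∃ (p : ℕ) (_ : Fact p.Prime) (k : ℕ) (X Y Z : Finset (GLm p 1)),
        RankSep k X Y Z ∧ budget p 1 k (2 + ε) < volume X Y Z ^ ((2 + ε) / 3)) := by
  intro h
  obtain ⟨p, hp, k, X, Y, Z, hsep, hlt⟩ := h 1 one_pos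
  exact not_design_matOne one_pos le_rfl hsep hlt

end Summit.MatrixMultiplication.MatrixMultiplication.Theorems.LieRankDesigns.Negative

end
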